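import Summits.AnomalousDissipation.AnomalousDissipation.Theorems.WazewskiBlockSubLaminarObliqueClass

/-!
# Route `WazewskiBlock`, item stmt-AnomalousDissipation-10354 — entries of the linearisation `linMatrix` inside a `k₀`-block

Diagonal entries, the vanishing pattern, the chain entries `k' = k ± e` for both polarisations and
the link products. All statements proved; no definitions.
-/

noncomputable section

set_option linter.dupNamespace false

open scoped InnerProductSpace ComplexConjugate
open Finset
open Literature.Analysis.FunctionSpaces Literature.Analysis.FunctionSpaces.Torus
open Literature.Analysis.FluidPDE Literature.Analysis.FluidPDE.Torus

namespace Summit.AnomalousDissipation.AnomalousDissipation.Theorems.Oblique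

/-! ### Representatives -/

/-- Representatives have `k₀ ≥ 0`. [folklore] -/
theorem fst_nonneg_of_mem_obliqueReps {N : ℕ} {k : Fin 3 → ℤ} (hk : k ∈ obliqueReps N) : 0 ≤ k 0 := by
  rcases (mem_obliqueReps.1 hk).2 with h | h
  · exact h.le
  · exact h.1.ge

/-- Representatives have `k₀ ≤ N`. [folklore] -/
theorem fst_le_of_mem_obliqueReps {N : ℕ} {k : Fin 3 → ℤ} (hk : k ∈ obliqueReps N) : k 0 ≤ N := by
  have hb := mem_freqBall.1 (mem_freqBall_of_mem_obliqueReps hk)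
  have h0 : ((k 0 : ℤ) : ℝ) ^ 2 ≤ (N : ℝ) ^ 2 :=
    (Finset.single_le_sum (f := fun j => ((k j : ℤ) : ℝ) ^ 2) (fun _ _ => sq_nonneg _) (Finset.mem_univ 0)).trans hb
  have : ((k 0 : ℤ) : ℝ) ≤ N := abs_le_of_sq_le_sq' h0 (Nat.cast_nonneg N) |>.2
  exact_mod_cast this

/-! ### Entries of `linMatrix` between representatives with the same `k₀` -/

/-- `repField q` vanishes off `±q.1`. [folklore] -/
theorem repField_eq_zero {N : ℕ} (q : ObliqueIndex N) {k : Fin 3 → ℤ} (h1 : k ≠ (q.1 : Fin 3 → ℤ))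
    (h2 : k ≠ -(q.1 : Fin 3 → ℤ)) : repField q k = 0 := by
  simp [repField, h1, h2]

/-- `repField q` at `q.1`. [folklore] -/
theorem repField_self {N : ℕ} (q : ObliqueIndex N) : repField q (q.1 : Fin 3 → ℤ) = basisVec (q.1 : Fin 3 → ℤ) q.2 := by
  simp [repField]

/-- A shifted representative `k + s e` (`s = ±1`) is never `-k'` for a representative `k'` with the
same first coordinate. [folklore] -/
theorem add_smul_modeE_ne_neg {N : ℕ} {k k' : Fin 3 → ℤ} (hk : k ∈ obliqueReps N) (hk' : k' ∈ obliqueReps N)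
    (h0 : k 0 = k' 0) (s : ℤ) (hs : s = 1 ∨ s = -1) : k + s • modeE ≠ -k' := by
  intro h
  have e0 : k 0 = -(k' 0) := by have := congrFun h 0; simpa [modeE_apply_zero] using this
  have e1 : k 1 + s * 2 = -(k' 1) := by have := congrFun h 1; simpa [modeE_apply_one] using this
  have hk0 := fst_nonneg_of_mem_obliqueReps hk
  have hk'0 := fst_nonneg_of_mem_obliqueReps hk'
  obtain ⟨hkm, hkrep⟩ := mem_obliqueReps.1 hk
  obtain ⟨hk'm, hk'rep⟩ := mem_obliqueReps.1 hk'
  obtain ⟨_, _, _, ⟨r, hr⟩⟩ := mem_obliqueModes.1 hkm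
  obtain ⟨_, _, _, ⟨r', hr'⟩⟩ := mem_obliqueModes.1 hk'm
  have hz : k 0 = 0 := le_antisymm (by linarith) hk0
  have hz' : k' 0 = 0 := by linarith
  rcases hkrep with h | ⟨_, h1⟩
  · exact absurd hz h.ne'
  · rcases hk'rep with h' | ⟨_, h1'⟩
    · exact absurd hz' h'.ne'
    · rcases hs with rfl | rfl <;> omega

/-- A shifted representative is never itself up to sign: `k + s e ≠ k` and `k + s e ≠ -k`
(`k₁` even, `e₁ = 2`). [folklore] -/
theorem add_smul_modeE_ne_self {N : ℕ} {k : Fin 3 → ℤ} (hk : k ∈ obliqueReps N) (s : ℤ) (hs : s = 1 ∨ s = -1) :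
    k + s • modeE ≠ k ∧ k + s • modeE ≠ -k := by
  obtain ⟨hkm, _⟩ := mem_obliqueReps.1 hk
  obtain ⟨_, _, _, heven⟩ := mem_obliqueModes.1 hkm
  constructor
  · intro h
    have := congrFun h 1
    simp [modeE_apply_one] at this
    rcases hs with rfl | rfl <;> omega
  · intro h
    have := congrFun h 1
    simp only [Pi.add_apply, Pi.smul_apply, modeE_apply_one, smul_eq_mul, Pi.neg_apply] at this
    obtain ⟨r, hr⟩ := heven
    rcases hs with rfl | rfl <;> omega

/-- **Diagonal entries**: `linMatrix p p = ν 4π² |k|²` (the laminar shear never couples a mode to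
itself). [folklore] -/
theorem linMatrix_diag (ν F : ℝ) {N : ℕ} (p : ObliqueIndex N) :
    linMatrix ν F N p p = ν * (4 * Real.pi ^ 2 * freqNormSq (p.1 : Fin 3 → ℤ)) := by
  have hm : (p.1 : Fin 3 → ℤ) - modeE = (p.1 : Fin 3 → ℤ) + (-1 : ℤ) • modeE := by simp [sub_eq_add_neg]
  have hp : (p.1 : Fin 3 → ℤ) + modeE = (p.1 : Fin 3 → ℤ) + (1 : ℤ) • modeE := by simp
  obtain ⟨a1, a2⟩ := add_smul_modeE_ne_self p.1.2 (-1) (Or.inr rfl)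
  obtain ⟨b1, b2⟩ := add_smul_modeE_ne_self p.1.2 1 (Or.inl rfl)
  simp only [linMatrix, Matrix.of_apply, if_true, hm, hp, repField_eq_zero p a1 a2, repField_eq_zero p b1 b2]
  simp

/-- **Off-diagonal entries within a `k₀`-block vanish unless `k' = k ∓ e`.** [folklore] -/
theorem linMatrix_eq_zero_of_ne (ν F : ℝ) {N : ℕ} (p q : ObliqueIndex N) (hpq : p ≠ q)
    (h1 : (p.1 : Fin 3 → ℤ) - modeE ≠ (q.1 : Fin 3 → ℤ)) (h1' : (p.1 : Fin 3 → ℤ) - modeE ≠ -(q.1 : Fin 3 → ℤ))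
    (h2 : (p.1 : Fin 3 → ℤ) + modeE ≠ (q.1 : Fin 3 → ℤ)) (h2' : (p.1 : Fin 3 → ℤ) + modeE ≠ -(q.1 : Fin 3 → ℤ)) :
    linMatrix ν F N p q = 0 := by
  simp only [linMatrix, Matrix.of_apply, if_neg hpq, repField_eq_zero q h1 h1', repField_eq_zero q h2 h2']
  simp

/-- **The entry for the column `k' = k - e`** (same polarisation `σ`):
`πA ( k₀ ⟪b_σ(k), b_σ(k')⟫ + 2 (b_σ k')₁ (b_σ k)₀ )`. [folklore] -/
theorem linMatrix_entry_sub (ν F : ℝ) {N : ℕ} (p q : ObliqueIndex N) (hσ : q.2 = p.2)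
    (h0 : (p.1 : Fin 3 → ℤ) 0 = (q.1 : Fin 3 → ℤ) 0) (hq : (q.1 : Fin 3 → ℤ) = (p.1 : Fin 3 → ℤ) - modeE) :
    linMatrix ν F N p q = Real.pi * (F / (16 * Real.pi ^ 2 * ν)) *
      ((((p.1 : Fin 3 → ℤ) 0 : ℤ) : ℝ) * ⟪basisVec (p.1 : Fin 3 → ℤ) p.2, basisVec (q.1 : Fin 3 → ℤ) p.2⟫_ℝ +
        2 * (basisVec (q.1 : Fin 3 → ℤ) p.2 1 * basisVec (p.1 : Fin 3 → ℤ) p.2 0)) := by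
  have hpq : p ≠ q := by
    intro h
    have h1 : (p.1 : Fin 3 → ℤ) - modeE = (p.1 : Fin 3 → ℤ) := by rw [← hq, h]
    exact (add_smul_modeE_ne_self p.1.2 (-1) (Or.inr rfl)).1 (by simpa [sub_eq_add_neg] using h1)
  have hplus : (p.1 : Fin 3 → ℤ) + modeE ≠ (q.1 : Fin 3 → ℤ) := by
    rw [hq]; intro h
    have := congrFun h 1; simp [modeE_apply_one] at this; omega
  have hplus' : (p.1 : Fin 3 → ℤ) + modeE ≠ -(q.1 : Fin 3 → ℤ) := by
    have := add_smul_modeE_ne_neg p.1.2 q.1.2 h0 1 (Or.inl rfl)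
    simpa using this
  have hsub_self : repField q ((p.1 : Fin 3 → ℤ) - modeE) = basisVec (q.1 : Fin 3 → ℤ) q.2 := by
    rw [← hq]; exact repField_self q
  simp only [linMatrix, Matrix.of_apply, if_neg hpq, zero_add, hsub_self, repField_eq_zero q hplus hplus', sub_zero,
    hσ, PiLp.zero_apply, add_zero]
  ring

/-- **The entry for the column `k' = k + e`** (same polarisation `σ`):
`πA ( -k₀ ⟪b_σ(k), b_σ(k')⟫ + 2 (b_σ k')₁ (b_σ k)₀ )`. [folklore] -/
theorem linMatrix_entry_add (ν F : ℝ) {N : ℕ} (p q : ObliqueIndex N) (hσ : q.2 = p.2)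
    (h0 : (p.1 : Fin 3 → ℤ) 0 = (q.1 : Fin 3 → ℤ) 0) (hq : (q.1 : Fin 3 → ℤ) = (p.1 : Fin 3 → ℤ) + modeE) :
    linMatrix ν F N p q = Real.pi * (F / (16 * Real.pi ^ 2 * ν)) *
      (-((((p.1 : Fin 3 → ℤ) 0 : ℤ) : ℝ) * ⟪basisVec (p.1 : Fin 3 → ℤ) p.2, basisVec (q.1 : Fin 3 → ℤ) p.2⟫_ℝ) +
        2 * (basisVec (q.1 : Fin 3 → ℤ) p.2 1 * basisVec (p.1 : Fin 3 → ℤ) p.2 0)) := by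
  have hpq : p ≠ q := by
    intro h
    have h1 : (p.1 : Fin 3 → ℤ) + modeE = (p.1 : Fin 3 → ℤ) := by rw [← hq, h]
    exact (add_smul_modeE_ne_self p.1.2 1 (Or.inl rfl)).1 (by simpa using h1)
  have hminus : (p.1 : Fin 3 → ℤ) - modeE ≠ (q.1 : Fin 3 → ℤ) := by
    rw [hq]; intro h
    have := congrFun h 1; simp [modeE_apply_one] at this; omega
  have hminus' : (p.1 : Fin 3 → ℤ) - modeE ≠ -(q.1 : Fin 3 → ℤ) := by
    have := add_smul_modeE_ne_neg p.1.2 q.1.2 h0 (-1) (Or.inr rfl)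
    simpa [sub_eq_add_neg] using this
  have hadd_self : repField q ((p.1 : Fin 3 → ℤ) + modeE) = basisVec (q.1 : Fin 3 → ℤ) q.2 := by
    rw [← hq]; exact repField_self q
  simp only [linMatrix, Matrix.of_apply, if_neg hpq, zero_add, hadd_self, repField_eq_zero q hminus hminus', zero_sub,
    hσ, inner_neg_right, PiLp.zero_apply, zero_add, mul_neg]
  ring

/-! ### The polarisation inner products along a chain -/

/-- `⟪inVec k, inVec k'⟫ = (k₁ k'₁ + 2 k₀²) / (|k| |k'|)` for lattice modes with the same `k₀`.
[folklore] -/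
theorem inner_inVec_inVec_of_fst_eq {N : ℕ} {k k' : Fin 3 → ℤ} (hk : k ∈ obliqueModes N) (hk' : k' ∈ obliqueModes N)
    (h0 : k 0 = k' 0) :
    ⟪inVec k, inVec k'⟫_ℝ = (((k 1 : ℤ) : ℝ) * ((k' 1 : ℤ) : ℝ) + 2 * ((k 0 : ℤ) : ℝ) ^ 2) /
      (Real.sqrt (freqNormSq k) * Real.sqrt (freqNormSq k')) := by
  have hpos := freqNormSq_pos_of_mem hk
  have hpos' := freqNormSq_pos_of_mem hk'
  have hs2 : Real.sqrt 2 ^ 2 = 2 := Real.sq_sqrt (by norm_num)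
  have hne1 : Real.sqrt 2 ≠ 0 := by positivity
  have hne2 : Real.sqrt (freqNormSq k) ≠ 0 := by positivity
  have hne3 : Real.sqrt (freqNormSq k') ≠ 0 := by positivity
  simp only [PiLp.inner_apply, RCLike.inner_apply, conj_trivial, Fin.sum_univ_three, inVec_apply_zero, inVec_apply_one,
    inVec_apply_two, ← h0]
  field_simp
  rw [hs2]
  ring

/-- The stretching coefficient `(inVec k')₁ (inVec k)₀ = -k'₀ k₁ / (|k| |k'|)`. [folklore] -/
theorem inVec_one_mul_inVec_zero {N : ℕ} {k k' : Fin 3 → ℤ} (hk : k ∈ obliqueModes N) (hk' : k' ∈ obliqueModes N) :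
    inVec k' 1 * inVec k 0 = -(((k' 0 : ℤ) : ℝ) * ((k 1 : ℤ) : ℝ)) /
      (Real.sqrt (freqNormSq k) * Real.sqrt (freqNormSq k')) := by
  have hpos := freqNormSq_pos_of_mem hk
  have hpos' := freqNormSq_pos_of_mem hk'
  have hs2 : Real.sqrt 2 ^ 2 = 2 := Real.sq_sqrt (by norm_num)
  have hne1 : Real.sqrt 2 ≠ 0 := by positivity
  have hne2 : Real.sqrt (freqNormSq k) ≠ 0 := by positivity
  have hne3 : Real.sqrt (freqNormSq k') ≠ 0 := by positivity
  rw [inVec_apply_one, inVec_apply_zero]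
  field_simp
  rw [hs2]

/-- **In-plane chain entries, closed form.** For in-plane representatives `k`, `k' = k + s e`
(`s = ∓1`) with the same `k₀`: `linMatrix (k,0) (k',0) = -s πA k₀ (|k'|² - 4) / (|k| |k'|)`.
[folklore] -/
theorem linMatrix_inplane_chain (ν F : ℝ) {N : ℕ} (p q : ObliqueIndex N) (hp : p.2 = 0) (hq2 : q.2 = 0)
    (h0 : (p.1 : Fin 3 → ℤ) 0 = (q.1 : Fin 3 → ℤ) 0) (s : ℤ) (hs : s = 1 ∨ s = -1)
    (hq : (q.1 : Fin 3 → ℤ) = (p.1 : Fin 3 → ℤ) + s • modeE) :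
    linMatrix ν F N p q = -(s : ℝ) * (Real.pi * (F / (16 * Real.pi ^ 2 * ν)) * (((p.1 : Fin 3 → ℤ) 0 : ℤ) : ℝ)) *
      (freqNormSq (q.1 : Fin 3 → ℤ) - 4) / (Real.sqrt (freqNormSq (p.1 : Fin 3 → ℤ)) * Real.sqrt (freqNormSq (q.1 : Fin 3 → ℤ))) := by
  have hkm := obliqueReps_subset N p.1.2
  have hk'm := obliqueReps_subset N q.1.2
  have hpos := freqNormSq_pos_of_mem hkm
  have hpos' := freqNormSq_pos_of_mem hk'm
  have hne2 : Real.sqrt (freqNormSq (p.1 : Fin 3 → ℤ)) ≠ 0 := by positivity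
  have hne3 : Real.sqrt (freqNormSq (q.1 : Fin 3 → ℤ)) ≠ 0 := by positivity
  have hq' := freqNormSq_eq_of_mem hk'm
  have hq1 : (q.1 : Fin 3 → ℤ) 1 = (p.1 : Fin 3 → ℤ) 1 + 2 * s := by
    rw [hq]; simp [modeE_apply_one]; ring
  have hσ : q.2 = p.2 := by rw [hp, hq2]
  rcases hs with rfl | rfl
  · rw [linMatrix_entry_add ν F p q hσ h0 (by simpa using hq), hp]
    simp only [basisVec, if_true]
    rw [inner_inVec_inVec_of_fst_eq hkm hk'm h0, inVec_one_mul_inVec_zero hkm hk'm, hq', ← h0, hq1]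
    field_simp
    push_cast
    ring
  · rw [linMatrix_entry_sub ν F p q hσ h0 (by simpa [sub_eq_add_neg] using hq), hp]
    simp only [basisVec, if_true]
    rw [inner_inVec_inVec_of_fst_eq hkm hk'm h0, inVec_one_mul_inVec_zero hkm hk'm, hq', ← h0, hq1]
    field_simp
    push_cast
    ring

/-- **Perpendicular chain entries**: `linMatrix (k,1) (k + s e, 1) = -s πA k₀` (pure advection).
[folklore] -/
theorem linMatrix_perp_chain (ν F : ℝ) {N : ℕ} (p q : ObliqueIndex N) (hp : p.2 = 1) (hq2 : q.2 = 1)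
    (h0 : (p.1 : Fin 3 → ℤ) 0 = (q.1 : Fin 3 → ℤ) 0) (s : ℤ) (hs : s = 1 ∨ s = -1)
    (hq : (q.1 : Fin 3 → ℤ) = (p.1 : Fin 3 → ℤ) + s • modeE) :
    linMatrix ν F N p q = -(s : ℝ) * (Real.pi * (F / (16 * Real.pi ^ 2 * ν)) * (((p.1 : Fin 3 → ℤ) 0 : ℤ) : ℝ)) := by
  have hσ : q.2 = p.2 := by rw [hp, hq2]
  rcases hs with rfl | rfl
  · rw [linMatrix_entry_add ν F p q hσ h0 (by simpa using hq), hp]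
    simp only [basisVec, Fin.isValue, one_ne_zero, if_false, inner_perpVec_perpVec, perpVec_apply_one]
    push_cast; ring
  · rw [linMatrix_entry_sub ν F p q hσ h0 (by simpa [sub_eq_add_neg] using hq), hp]
    simp only [basisVec, Fin.isValue, one_ne_zero, if_false, inner_perpVec_perpVec, perpVec_apply_one]
    push_cast; ring

/-- **In-plane link product**: for in-plane representatives `k` and `k₊ = k + e` with the same `k₀`,
`M(k,k₊) M(k₊,k) = -(πA k₀)² (|k₊|²-4)(|k|²-4) / (|k|² |k₊|²)`. [folklore] -/
theorem linMatrix_inplane_link (ν F : ℝ) {N : ℕ} (p q : ObliqueIndex N) (hp : p.2 = 0) (hq2 : q.2 = 0)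
    (h0 : (p.1 : Fin 3 → ℤ) 0 = (q.1 : Fin 3 → ℤ) 0) (hq : (q.1 : Fin 3 → ℤ) = (p.1 : Fin 3 → ℤ) + modeE) :
    linMatrix ν F N p q * linMatrix ν F N q p =
      -((Real.pi * (F / (16 * Real.pi ^ 2 * ν)) * (((p.1 : Fin 3 → ℤ) 0 : ℤ) : ℝ)) ^ 2) *
        ((freqNormSq (q.1 : Fin 3 → ℤ) - 4) * (freqNormSq (p.1 : Fin 3 → ℤ) - 4)) /
          (freqNormSq (p.1 : Fin 3 → ℤ) * freqNormSq (q.1 : Fin 3 → ℤ)) := by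
  have hkm := obliqueReps_subset N p.1.2
  have hk'm := obliqueReps_subset N q.1.2
  have hpos := freqNormSq_pos_of_mem hkm
  have hpos' := freqNormSq_pos_of_mem hk'm
  have hp' : (p.1 : Fin 3 → ℤ) = (q.1 : Fin 3 → ℤ) + (-1 : ℤ) • modeE := by rw [hq]; simp
  rw [linMatrix_inplane_chain ν F p q hp hq2 h0 1 (Or.inl rfl) (by simpa using hq),
    linMatrix_inplane_chain ν F q p hq2 hp h0.symm (-1) (Or.inr rfl) hp', ← h0]
  set a : ℝ := Real.sqrt (freqNormSq (p.1 : Fin 3 → ℤ)) with ha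
  set b : ℝ := Real.sqrt (freqNormSq (q.1 : Fin 3 → ℤ)) with hb
  have hs : a ^ 2 = freqNormSq (p.1 : Fin 3 → ℤ) := Real.sq_sqrt hpos.le
  have hs' : b ^ 2 = freqNormSq (q.1 : Fin 3 → ℤ) := Real.sq_sqrt hpos'.le
  have hne2 : a ≠ 0 := by rw [ha]; positivity
  have hne3 : b ≠ 0 := by rw [hb]; positivity
  rw [← hs, ← hs']
  field_simp
  push_cast
  ring

/-- **Perpendicular link product**: `M(k,k₊) M(k₊,k) = -(πA k₀)² ≤ 0`. [folklore] -/
theorem linMatrix_perp_link (ν F : ℝ) {N : ℕ} (p q : ObliqueIndex N) (hp : p.2 = 1) (hq2 : q.2 = 1)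
    (h0 : (p.1 : Fin 3 → ℤ) 0 = (q.1 : Fin 3 → ℤ) 0) (hq : (q.1 : Fin 3 → ℤ) = (p.1 : Fin 3 → ℤ) + modeE) :
    linMatrix ν F N p q * linMatrix ν F N q p =
      -((Real.pi * (F / (16 * Real.pi ^ 2 * ν)) * (((p.1 : Fin 3 → ℤ) 0 : ℤ) : ℝ)) ^ 2) := by
  have hp' : (p.1 : Fin 3 → ℤ) = (q.1 : Fin 3 → ℤ) + (-1 : ℤ) • modeE := by rw [hq]; simp
  rw [linMatrix_perp_chain ν F p q hp hq2 h0 1 (Or.inl rfl) (by simpa using hq),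
    linMatrix_perp_chain ν F q p hq2 hp h0.symm (-1) (Or.inr rfl) hp', ← h0]
  push_cast
  ring

end Summit.AnomalousDissipation.AnomalousDissipation.Theorems.Oblique

end
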